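import Mathlib
import HarnessLib
import Literature.NumberTheory.Automorphic.HyperbolicLaplaceSpectrum
import Literature.NumberTheory.Automorphic.InvariantLaplacian
import Literature.NumberTheory.Automorphic.HigherGreenFunctionCM

/-!
# Stub `stub_barrier` of line `Sketch`, crux `CorrespondentFingerprint` (stmt-Langlands-15898)

A bounded, `1`-periodic `C²` solution of `Δu = c u` on `ℍ` with `c > 0` (Iwaniec's
`Δ = y²(∂ₓ² + ∂_y²)`, the tree's `hypLaplacian`) vanishes identically.

Proof: interior maximum principle with the barrier `w = y^s + y^{1-s}`, `s(s-1) = c`, `s > 1`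
(`y² Δₑ w = c w`, `w → ∞` at both ends of the strip). For `ε > 0` the `1`-periodic function
`v = Re u - ε w` is negative outside a band `Y₀ ≤ y ≤ Y₁`, so a positive value of `v` would give
an interior maximum (over the compact period box, by periodicity a global one), where the
Euclidean Laplacian is `≤ 0` (the tree's `ResolventGreenUnique.laplacian_nonpos_of_isLocalMax`,
`HigherGreenFunctionCM.lean`) but equals `(c/y²) v > 0`. Hence `Re u ≤ 0`; the same for the
real-linear functionals `-Re`, `±Im` gives `u = 0`. The Laplacian of `y^s` is the tree's
`laplacian_im_cpow` (`InvariantLaplacian.lean`) transported to real powers.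

References: H. Iwaniec, *Spectral Methods of Automorphic Forms*, GSM 53 (2002), (1.19)–(1.23);
D. Gilbarg, N. Trudinger, *Elliptic PDE of Second Order*, Cor. 3.2 (maximum principle, `c ≤ 0`).
-/

set_option linter.dupNamespace false

noncomputable section

namespace Summit.Langlands.Langlands.Theorems.CorrespondentFingerprint

open Laplacian InnerProductSpace UpperHalfPlane Filter Topology Set Complex

/-! ### 1. The barrier `y^s + y^{1-s}` -/

/-- `w ↦ (Im w)^a` (real power) is `C²` at every point of the upper half-plane. [folklore] -/
theorem contDiffAt_im_rpow (a : ℝ) {z : ℂ} (hz : 0 < z.im) :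
    ContDiffAt ℝ 2 (fun w : ℂ => w.im ^ a) z :=
  (Real.contDiffAt_rpow_const_of_ne (p := a) hz.ne').comp z Complex.imCLM.contDiff.contDiffAt

/-- `Δₑ (Im w)^a = a(a-1) (Im w)^{a-2}` at a point of the upper half-plane (real powers; the
tree's `laplacian_im_cpow` transported along `ofReal`). [cite: Iwaniec2002, (1.22)–(1.23)] -/
theorem laplacian_im_rpow (a : ℝ) {z : ℂ} (hz : 0 < z.im) :
    Δ (fun w : ℂ => w.im ^ a) z = a * (a - 1) * z.im ^ (a - 2) := by
  have hC2 : ContDiffAt ℝ 2 (fun w : ℂ => w.im ^ a) z := contDiffAt_im_rpow a hz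
  have h1 : Δ (Complex.ofRealCLM ∘ (fun w : ℂ => w.im ^ a)) z
      = ((Δ (fun w : ℂ => w.im ^ a) z : ℝ) : ℂ) := by
    rw [hC2.laplacian_CLM_comp_left]
    rfl
  have h2 : (Complex.ofRealCLM ∘ (fun w : ℂ => w.im ^ a)) =ᶠ[𝓝 z]
      fun w : ℂ => ((w.im : ℂ)) ^ (a : ℂ) := by
    filter_upwards [isOpen_upperHalfPlaneSet.mem_nhds hz] with w hw
    have hw' : 0 < w.im := hw
    simp [Complex.ofReal_cpow hw'.le]
  have h3 := (laplacian_congr_nhds h2).self_of_nhds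
  rw [h1, Literature.NumberTheory.Automorphic.laplacian_im_cpow (a : ℂ) hz] at h3
  apply Complex.ofReal_injective
  rw [h3]
  push_cast
  rw [Complex.ofReal_cpow hz.le]
  push_cast
  ring

/-- The barrier `w(z) = (Im z)^s + (Im z)^{1-s}` (sum of the two solutions `y^s`, `y^{1-s}` of
`y² w'' = s(s-1) w`, (1.23)) is `C²` on the upper half-plane. [cite: Iwaniec2002, (1.23)] -/
theorem contDiffAt_barrier (s : ℝ) {z : ℂ} (hz : 0 < z.im) :
    ContDiffAt ℝ 2 (fun w : ℂ => w.im ^ s + w.im ^ (1 - s)) z :=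
  (contDiffAt_im_rpow s hz).add (contDiffAt_im_rpow (1 - s) hz)

/-- **The barrier is an eigenfunction**: `y² Δₑ (y^s + y^{1-s}) = s(s-1) (y^s + y^{1-s})` on the
upper half-plane. [cite: Iwaniec2002, (1.22)–(1.23)] -/
theorem sq_mul_laplacian_barrier (s : ℝ) {z : ℂ} (hz : 0 < z.im) :
    z.im ^ 2 * Δ (fun w : ℂ => w.im ^ s + w.im ^ (1 - s)) z
      = s * (s - 1) * (z.im ^ s + z.im ^ (1 - s)) := by
  have e : (fun w : ℂ => w.im ^ s + w.im ^ (1 - s))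
      = (fun w : ℂ => w.im ^ s) + fun w : ℂ => w.im ^ (1 - s) := rfl
  rw [e, (contDiffAt_im_rpow s hz).laplacian_add (contDiffAt_im_rpow (1 - s) hz),
    laplacian_im_rpow s hz, laplacian_im_rpow (1 - s) hz]
  have h1 : z.im ^ (2 : ℕ) * z.im ^ (s - 2) = z.im ^ s := by
    rw [← Real.rpow_natCast, ← Real.rpow_add hz]
    norm_num
  have h2 : z.im ^ (2 : ℕ) * z.im ^ (1 - s - 2) = z.im ^ (1 - s) := by
    rw [← Real.rpow_natCast, ← Real.rpow_add hz]
    congr 1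
    push_cast
    ring
  calc z.im ^ 2 * (s * (s - 1) * z.im ^ (s - 2) + (1 - s) * (1 - s - 1) * z.im ^ (1 - s - 2))
      = s * (s - 1) * (z.im ^ (2 : ℕ) * z.im ^ (s - 2))
          + s * (s - 1) * (z.im ^ (2 : ℕ) * z.im ^ (1 - s - 2)) := by ring
    _ = s * (s - 1) * (z.im ^ s + z.im ^ (1 - s)) := by rw [h1, h2]; ring

/-! ### 2. The maximum principle on the period strip -/

/-- `1`-periodicity on the upper half-plane extends to all integer translates. [folklore] -/
theorem periodic_intCast {F : ℂ → ℝ} (hper : ∀ z : ℂ, 0 < z.im → F (z + 1) = F z) (n : ℤ) :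
    ∀ z : ℂ, 0 < z.im → F (z + n) = F z := by
  induction n with
  | zero => intro z _; simp
  | succ i ih =>
    intro z hz
    have h1 : z + ((i : ℤ) + 1 : ℤ) = (z + (i : ℤ)) + 1 := by push_cast; ring
    have hzi : 0 < (z + ((i : ℤ) : ℂ)).im := by simpa using hz
    rw [h1, hper _ hzi, ih z hz]
  | pred i ih =>
    intro z hz
    have hzi : 0 < (z + ((-(i : ℤ) - 1 : ℤ) : ℂ)).im := by simpa using hz
    have h1 : z + ((-(i : ℤ) - 1 : ℤ) : ℂ) + 1 = z + ((-(i : ℤ) : ℤ) : ℂ) := by push_cast; ring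
    rw [← hper _ hzi, h1, ih z hz]

/-- **Maximum principle on the strip.** A `1`-periodic real `C²` function on the upper half-plane
with `y² Δₑ F = c F`, `c > 0`, which is bounded above, is `≤ 0` (barrier `ε (y^s + y^{1-s})`,
`s(s-1) = c`, and the second-order condition at an interior maximum of `F - ε w` over the period
box). [cite: Iwaniec2002, (1.22)–(1.23)] -/
theorem nonpos_of_periodic_of_le {F : ℂ → ℝ} {c C : ℝ} (hc : 0 < c)
    (hF2 : ContDiffOn ℝ 2 F {z : ℂ | 0 < z.im})
    (hFeq : ∀ z : ℂ, 0 < z.im → z.im ^ 2 * Δ F z = c * F z)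
    (hper : ∀ z : ℂ, 0 < z.im → F (z + 1) = F z)
    (hbdd : ∀ z : ℂ, 0 < z.im → F z ≤ C) :
    ∀ z : ℂ, 0 < z.im → F z ≤ 0 := by
  by_contra! h
  obtain ⟨z₀, hz₀, hF0⟩ := h
  -- the exponent `s > 1` with `s(s-1) = c`
  set s : ℝ := 1 / 2 + Real.sqrt (1 / 4 + c) with hs_def
  have hsqrt : (1 / 2 : ℝ) < Real.sqrt (1 / 4 + c) := by
    have h14 : Real.sqrt (1 / 4 : ℝ) = 1 / 2 := by
      rw [show (1 / 4 : ℝ) = (1 / 2) ^ 2 by norm_num, Real.sqrt_sq (by norm_num)]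
    rw [← h14]
    exact Real.sqrt_lt_sqrt (by norm_num) (by linarith)
  have hs1 : 1 < s := by rw [hs_def]; linarith
  have hss : s * (s - 1) = c := by
    have h := Real.sq_sqrt (show (0 : ℝ) ≤ 1 / 4 + c by positivity)
    calc s * (s - 1) = Real.sqrt (1 / 4 + c) ^ 2 - 1 / 4 := by rw [hs_def]; ring
      _ = c := by rw [h]; ring
  -- the comparison function `v = F - ε w`
  set w : ℂ → ℝ := fun z => z.im ^ s + z.im ^ (1 - s) with hw_def
  have hw_lo : ∀ z : ℂ, 0 < z.im → z.im ^ s ≤ w z ∧ z.im ^ (1 - s) ≤ w z := fun z hz =>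
    ⟨le_add_of_nonneg_right (Real.rpow_nonneg hz.le _),
      le_add_of_nonneg_left (Real.rpow_nonneg hz.le _)⟩
  have hC : 0 < C := lt_of_lt_of_le hF0 (hbdd z₀ hz₀)
  have hw0 : 0 < w z₀ := add_pos (Real.rpow_pos_of_pos hz₀ _) (Real.rpow_pos_of_pos hz₀ _)
  set ε : ℝ := F z₀ / (2 * w z₀) with hε_def
  have hε : 0 < ε := by positivity
  set v : ℂ → ℝ := fun z => F z - ε * w z with hv_def
  have hεw : ε * w z₀ = F z₀ / 2 := by
    rw [hε_def]
    field_simp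
  have hv0 : 0 < v z₀ := by
    simp only [hv_def]
    rw [hεw]
    linarith
  -- `v < 0` above the band
  set Y₁ : ℝ := C / ε + 1 with hY₁_def
  have hCε : 0 < C / ε := by positivity
  have htop : ∀ z : ℂ, Y₁ < z.im → v z < 0 := by
    intro z hz
    have hzpos : 0 < z.im := by linarith
    have h1 : z.im ≤ z.im ^ s := Real.self_le_rpow_of_one_le (by linarith) hs1.le
    have h2 : z.im ^ s ≤ w z := (hw_lo z hzpos).1
    have h3 : C < ε * z.im := by
      have := (div_lt_iff₀ hε).mp (by linarith : C / ε < z.im)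
      linarith
    have h4 : ε * z.im ≤ ε * w z := mul_le_mul_of_nonneg_left (h1.trans h2) hε.le
    simp only [hv_def]
    linarith [hbdd z hzpos]
  -- `v < 0` below the band
  set Y₀ : ℝ := ((C + ε) / ε) ^ (1 / (1 - s)) with hY₀_def
  have hY₀ : 0 < Y₀ := Real.rpow_pos_of_pos (by positivity) _
  have hbot : ∀ z : ℂ, 0 < z.im → z.im < Y₀ → v z < 0 := by
    intro z hzpos hz
    have h1 : Y₀ ^ (1 - s) ≤ z.im ^ (1 - s) :=
      Real.rpow_le_rpow_of_nonpos hzpos hz.le (by linarith)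
    have h2 : Y₀ ^ (1 - s) = (C + ε) / ε := by
      rw [hY₀_def, one_div, Real.rpow_inv_rpow (by positivity) (by linarith)]
    have h3 : z.im ^ (1 - s) ≤ w z := (hw_lo z hzpos).2
    have h4 : ε * ((C + ε) / ε) = C + ε := by field_simp
    have h5 : C + ε ≤ ε * w z := by
      rw [← h4]
      exact mul_le_mul_of_nonneg_left ((h2 ▸ h1).trans h3) hε.le
    simp only [hv_def]
    linarith [hbdd z hzpos]
  -- hence `z₀` lies in the band
  have hz₀top : z₀.im ≤ Y₁ := by
    by_contra h
    linarith [htop z₀ (not_le.mp h)]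
  have hz₀bot : Y₀ ≤ z₀.im := by
    by_contra h
    linarith [hbot z₀ hz₀ (not_le.mp h)]
  -- the compact period box
  set K : Set ℂ := (Icc (0 : ℝ) 1) ×ℂ (Icc Y₀ Y₁) with hK_def
  have hK : IsCompact K := isCompact_Icc.reProdIm isCompact_Icc
  have hKU : ∀ z ∈ K, 0 < z.im := fun z hz => lt_of_lt_of_le hY₀ (mem_reProdIm.mp hz).2.1
  have htrans : ∀ z : ℂ, 0 < z.im → Y₀ ≤ z.im → z.im ≤ Y₁ → ∃ z' ∈ K, v z' = v z := by
    intro z hz hb ht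
    refine ⟨z + ((-⌊z.re⌋ : ℤ) : ℂ), ?_, ?_⟩
    · rw [hK_def, mem_reProdIm]
      simp only [Complex.add_re, Complex.intCast_re, Complex.add_im, Complex.intCast_im,
        Complex.neg_re, Complex.neg_im, neg_zero, add_zero, Int.cast_neg, mem_Icc]
      refine ⟨⟨?_, ?_⟩, hb, ht⟩
      · linarith [Int.floor_le z.re]
      · linarith [Int.lt_floor_add_one z.re]
    · simp only [hv_def, hw_def]
      rw [periodic_intCast hper _ z hz]
      simp
  have hvC2 : ∀ z : ℂ, 0 < z.im → ContDiffAt ℝ 2 v z := fun z hz =>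
    (hF2.contDiffAt (isOpen_upperHalfPlaneSet.mem_nhds hz)).sub
      (contDiffAt_const.mul (contDiffAt_barrier s hz))
  have hvcont : ContinuousOn v K := fun z hz =>
    (hvC2 z (hKU z hz)).continuousAt.continuousWithinAt
  obtain ⟨z₀', hz₀'K, hvz₀'⟩ := htrans z₀ hz₀ hz₀bot hz₀top
  obtain ⟨z₁, hz₁K, hmax⟩ := hK.exists_isMaxOn ⟨z₀', hz₀'K⟩ hvcont
  have hz₁ : 0 < z₁.im := hKU z₁ hz₁K
  have hv1 : 0 < v z₁ := lt_of_lt_of_le hv0 (hvz₀' ▸ hmax hz₀'K)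
  -- `z₁` is a global, hence local, maximum of `v` on the upper half-plane
  have hglob : ∀ z : ℂ, 0 < z.im → v z ≤ v z₁ := by
    intro z hz
    by_cases hb : Y₀ ≤ z.im
    · by_cases ht : z.im ≤ Y₁
      · obtain ⟨z', hz'K, hvz'⟩ := htrans z hz hb ht
        rw [← hvz']
        exact hmax hz'K
      · exact ((htop z (not_le.mp ht)).trans hv1).le
    · exact ((hbot z hz (not_le.mp hb)).trans hv1).le
  have hlocmax : IsLocalMax v z₁ :=
    Filter.eventually_of_mem (isOpen_upperHalfPlaneSet.mem_nhds hz₁) fun z hz => hglob z hz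
  -- the Laplacian at `z₁`: `≤ 0` by the second-order condition, `= (c / y²) v > 0` by the equation
  have hΔ := Literature.NumberTheory.Automorphic.ResolventGreenUnique.laplacian_nonpos_of_isLocalMax
    hlocmax (hvC2 z₁ hz₁)
  have hFz : ContDiffAt ℝ 2 F z₁ := hF2.contDiffAt (isOpen_upperHalfPlaneSet.mem_nhds hz₁)
  have hwz : ContDiffAt ℝ 2 w z₁ := contDiffAt_barrier s hz₁
  have hwz' : ContDiffAt ℝ 2 (ε • w) z₁ := hwz.const_smul ε
  have hveq : v = F - ε • w := by
    funext z
    simp [hv_def, smul_eq_mul]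
  have hΔv : Δ v z₁ = Δ F z₁ - ε * Δ w z₁ := by
    rw [hveq, hFz.laplacian_sub hwz', laplacian_smul ε hwz, smul_eq_mul]
  have key : z₁.im ^ 2 * Δ v z₁ = c * v z₁ := by
    rw [hΔv, mul_sub, hFeq z₁ hz₁, mul_left_comm, hw_def, sq_mul_laplacian_barrier s hz₁, hss]
    simp only [hv_def]
    ring
  have h5 : 0 < z₁.im ^ 2 * Δ v z₁ := by
    rw [key]
    exact mul_pos hc hv1
  have h6 : z₁.im ^ 2 * Δ v z₁ ≤ 0 := mul_nonpos_of_nonneg_of_nonpos (sq_nonneg _) hΔ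
  linarith

/-- The maximum principle applied to a real-linear functional of a complex solution: for
`G : ℂ → ℂ` of class `C²`, `1`-periodic and bounded on the upper half-plane with
`y² Δₑ G = c G`, `c > 0`, and `l : ℂ →L[ℝ] ℝ`, the function `l ∘ G` is `≤ 0` there.
[cite: Iwaniec2002, (1.22)–(1.23)] -/
theorem clm_apply_nonpos {G : ℂ → ℂ} {c C : ℝ} (hc : 0 < c)
    (hG2 : ContDiffOn ℝ 2 G {z : ℂ | 0 < z.im})
    (hGeq : ∀ z : ℂ, 0 < z.im → (z.im : ℂ) ^ 2 * Δ G z = (c : ℂ) * G z)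
    (hper : ∀ z : ℂ, 0 < z.im → G (z + 1) = G z)
    (hbdd : ∀ z : ℂ, 0 < z.im → ‖G z‖ ≤ C) (l : ℂ →L[ℝ] ℝ) :
    ∀ z : ℂ, 0 < z.im → l (G z) ≤ 0 := by
  have h := nonpos_of_periodic_of_le (F := l ∘ G) (C := ‖l‖ * C) hc
    (l.contDiff.comp_contDiffOn hG2) ?_ ?_ ?_
  · intro z hz
    exact h z hz
  · intro z hz
    have hGz : ContDiffAt ℝ 2 G z := hG2.contDiffAt (isOpen_upperHalfPlaneSet.mem_nhds hz)
    have h1 : Δ (l ∘ G) z = l (Δ G z) := hGz.laplacian_CLM_comp_left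
    have h2 := congrArg l (hGeq z hz)
    have e1 : ((z.im : ℂ)) ^ 2 * Δ G z = (z.im ^ 2 : ℝ) • Δ G z := by
      rw [Complex.real_smul]
      push_cast
      rfl
    have e2 : (c : ℂ) * G z = c • G z := by rw [Complex.real_smul]
    rw [e1, e2, l.map_smul, l.map_smul] at h2
    rw [h1]
    simpa [smul_eq_mul] using h2
  · intro z hz
    simp [hper z hz]
  · intro z hz
    calc (l ∘ G) z = l (G z) := rfl
      _ ≤ ‖l (G z)‖ := Real.le_norm_self _
      _ ≤ ‖l‖ * ‖G z‖ := l.le_opNorm _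
      _ ≤ ‖l‖ * C := mul_le_mul_of_nonneg_left (hbdd z hz) (norm_nonneg _)

/-! ### 3. The stub -/

/-- **STUB `stub_barrier`** (card `rational-centre-parity-barrier`, first lemma): a bounded,
`1`-periodic, `C²` solution of `Δu = c u` on `ℍ` with `c > 0` (Iwaniec's `Δ = y²(∂ₓ² + ∂_y²)`)
vanishes identically (interior maximum principle for `Re u - ε (y^s + y^{1-s})`, `s(s-1) = c`).
[cite: Iwaniec2002, (1.19)–(1.23)] -/
theorem stub_barrier : ∀ (u : UpperHalfPlane → ℂ) (c : ℝ), 0 < c →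
    Literature.NumberTheory.Automorphic.IsC2 u →
    (∀ z, Literature.NumberTheory.Automorphic.hypLaplacian u z = (c : ℂ) * u z) →
    (∀ z : UpperHalfPlane, u ((1 : ℝ) +ᵥ z) = u z) →
    (∃ C : ℝ, ∀ z, ‖u z‖ ≤ C) → ∀ z, u z = 0 := by
  intro u c hc hu heig hper hbdd z
  obtain ⟨C, hC⟩ := hbdd
  set G : ℂ → ℂ := u ∘ ofComplex with hG
  have hGval : ∀ (w : ℂ) (hw : 0 < w.im), G w = u ⟨w, hw⟩ := fun w hw => by
    simp [hG, ofComplex_apply_of_im_pos hw]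
  have hG2 : ContDiffOn ℝ 2 G {z : ℂ | 0 < z.im} := hu
  have hGeq : ∀ w : ℂ, 0 < w.im → (w.im : ℂ) ^ 2 * Δ G w = (c : ℂ) * G w := by
    intro w hw
    have h := heig ⟨w, hw⟩
    simp only [Literature.NumberTheory.Automorphic.hypLaplacian] at h
    rw [hGval w hw]
    exact h
  have hGper : ∀ w : ℂ, 0 < w.im → G (w + 1) = G w := by
    intro w hw
    have hw1 : 0 < (w + 1).im := by simpa using hw
    rw [hGval _ hw1, hGval w hw]
    have h := hper ⟨w, hw⟩
    convert h using 2
    ext1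
    simp [UpperHalfPlane.coe_vadd, add_comm]
  have hGbdd : ∀ w : ℂ, 0 < w.im → ‖G w‖ ≤ C := fun w hw => by
    rw [hGval w hw]
    exact hC _
  have key := fun l : ℂ →L[ℝ] ℝ => clm_apply_nonpos hc hG2 hGeq hGper hGbdd l (z : ℂ) z.im_pos
  have hGz : G (z : ℂ) = u z := by simp [hG, ofComplex_apply]
  rw [← hGz]
  apply Complex.ext
  · apply le_antisymm
    · simpa using key Complex.reCLM
    · simpa using key (-Complex.reCLM)
  · apply le_antisymm
    · simpa using key Complex.imCLM
    · simpa using key (-Complex.imCLM)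

end Summit.Langlands.Langlands.Theorems.CorrespondentFingerprint

end
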